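import Summits.Ventures.PercRepro.RankLevelSetTightLayer

/-!
# PercRepro — THE TIGHT LAYER OF (MC): contraction monotonicity of the slack at an unexposed element
(night-1, gen 9; paper proofs/NIGHT-1-C025-induction.md §19; part 2 of 2)

On the TIGHT LAYER `|E| = p + q` (RankLevelSetTightLayer: `U_M(p,q) = {A ∈ I_p : E ∖ A ∈ I}`,
`#Y = Σ_{q<u<p} i_u + #depMid`, the injection of the dependent middle sets) and with THEOREM (a_p)
(`indepSlack_contract_le`, d1830: the pure independent-set slack is contraction-monotone),

  `σ_M(p,q) − σ_{M／e}(p−1,q) = [τ′_M − τ′_{M／e}] + (dependent middle sets of `M` not hit by `M／e`)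
        + Φ(p,q)·#{A ∈ I_p : E∖A ∉ I} − Φ(p−1,q)·#{A′ ∈ I_{p−1}(M／e) : E′∖A′ ∉ I(M／e)}`,

and the last count is `#{A ∈ I_p : e ∈ A, E∖A ∉ I} + b″(e)` with `b″(e) = #{A ∈ I_p : e ∈ A, E∖A ∈ I, e ∈ cl(E∖A)}`
— the partitions of `U_M(p,q)` in which `e` lies in the closure of the other side (a circuit through `e` of
size `≤ q + 1`).  Hence:

* **`slack_contract_le_of_tight`** — on the tight layer, if `b″(e) = 0` (hypothesis `hb`), then
  `σ_{M／e}(p−1,q) ≤ σ_M(p,q)`: (MC), hence (MC-2) = C-037, holds at `e`;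
* **`slack_contract_le_of_tight_of_circuits`** — in particular at every `e` lying in no circuit of size `≤ q + 1`.

Pieces: `ncard_badImg_contract_le` (the injection `A′ ↦ insert e A′` on the independent sets with dependent
complement — where `hb` enters), `indepSlack_eq_of_ncard_eq` (`τ′ = Σ i_u − Φ(p,q)·i_p` at `|E| = p + q`),
`phiK_le_phiK_succ`, `phiK_pred_le`.  Axioms: standard.
-/

open scoped Matroid

namespace PercRepro

open Set Finset

variable {α : Type} (M : Matroid α) [M.Finite]

/-- THE BAD INJECTION (where the hypothesis enters): if no `A ∈ I_p` with `e ∈ A` and independent complement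
has `e ∈ cl(E ∖ A)`, then `A′ ↦ insert e A′` maps the bad independent `(p−1)`-sets of `M ／ {e}` (complement
dependent in `M ／ {e}`) into the bad independent `p`-sets of `M`. -/
lemma ncard_badImg_contract_le {e : α} (he : M.IsNonloop e) {p : ℕ} (hp : 1 ≤ p)
    (hb : ∀ A : Set α, A ⊆ M.E → M.Indep A → A.encard = (p : ℕ∞) → e ∈ A →
      M.Indep (M.E \ A) → e ∉ M.closure (M.E \ A)) :
    (badImg (M ／ {e}) (p - 1)).ncard ≤ (badImg M p).ncard := by
  have hefin : (M ／ {e}).Finite := inferInstance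
  refine ncard_le_ncard_of_injOn (fun A => insert e A) ?_ ?_ ((indImg_finite M p).sdiff)
  · rintro A ⟨hA, hbad⟩
    rw [mem_indImg_iff] at hA
    obtain ⟨hAE, hAind, hcard⟩ := hA
    have heA : e ∉ A := fun h => (hAE h).2 rfl
    have hAind' : M.Indep (insert e A) := (he.contractElem_indep_iff.1 hAind).2
    have hAE' : insert e A ⊆ M.E :=
      insert_subset he.mem_ground (hAE.trans (M.contract_ground_subset_ground {e}))
    have hcard' : (insert e A).encard = (p : ℕ∞) := by
      rw [encard_insert_of_notMem heA, hcard]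
      norm_cast
      omega
    refine ⟨?_, ?_⟩
    · rw [mem_indImg_iff]
      exact ⟨hAE', hAind', hcard'⟩
    · intro hind'
      apply hbad
      change (M ／ {e}).Indep ((M ／ {e}).E \ A)
      rw [← ground_sdiff_insert M e A]
      change M.Indep (M.E \ insert e A) at hind'
      have hecl := hb (insert e A) hAE' hAind' hcard' (mem_insert e A) hind'
      have hnot : e ∉ M.E \ insert e A := fun h => h.2 (mem_insert e A)
      rw [he.contractElem_indep_iff]
      refine ⟨hnot, ?_⟩
      rw [hind'.insert_indep_iff_of_notMem hnot]
      exact ⟨he.mem_ground, hecl⟩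
  · rintro A ⟨hA, -⟩ A' ⟨hA', -⟩ hEq
    rw [mem_indImg_iff] at hA hA'
    have heA : e ∉ A := fun h => (hA.1 h).2 rfl
    have heA' : e ∉ A' := fun h => (hA'.1 h).2 rfl
    have h1 : insert e A \ {e} = insert e A' \ {e} := by
      simp only at hEq
      rw [hEq]
    rwa [insert_sdiff_self_of_notMem heA, insert_sdiff_self_of_notMem heA'] at h1

/-- On the tight layer `|E| = p + q` the pure independent-set slack is `Σ_{q<u<p} i_u − Φ(p,q)·i_p`. -/
lemma indepSlack_eq_of_ncard_eq {p q : ℕ} (hE : M.E.ncard = p + q) :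
    indepSlack M p q = ∑ u ∈ Finset.Ioo q p, ((indepSets M u).card : ℚ) -
      phiK p q * ((indepSets M p).card : ℚ) := by
  unfold indepSlack phiK
  rw [hE, Finset.sum_sub_distrib, ← Finset.sum_mul, ← Finset.sum_div]

/-- `Φ(p, q) ≤ Φ(p + 1, q)`: termwise `C(p+q,u)/C(p+q,p) ≤ C(p+q+1,u)/C(p+q+1,p+1)` for `q < u`, plus the
new nonnegative term `u = p`. -/
lemma phiK_le_phiK_succ (p q : ℕ) : phiK p q ≤ phiK (p + 1) q := by
  unfold phiK
  have hpos : (0 : ℚ) < ((p + q).choose p : ℚ) := by exact_mod_cast Nat.choose_pos (by omega)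
  have hpos' : (0 : ℚ) < ((p + 1 + q).choose (p + 1) : ℚ) := by
    exact_mod_cast Nat.choose_pos (by omega)
  rw [div_le_div_iff₀ hpos hpos', Finset.sum_mul, Finset.sum_mul]
  have hsub : Finset.Ioo q p ⊆ Finset.Ioo q (p + 1) := by
    intro u hu
    rw [Finset.mem_Ioo] at hu ⊢
    omega
  -- C(n+1,p+1)·(p+1) = (n+1)·C(n,p), n = p + q
  have h1 : ((p + 1 + q).choose (p + 1) : ℚ) * (p + 1) = (p + q + 1) * ((p + q).choose p : ℚ) := by
    rw [show p + 1 + q = p + q + 1 by ring]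
    exact_mod_cast (Nat.add_one_mul_choose_eq (p + q) p).symm
  calc ∑ u ∈ Finset.Ioo q p, ((p + q).choose u : ℚ) * ((p + 1 + q).choose (p + 1) : ℚ)
      ≤ ∑ u ∈ Finset.Ioo q p, ((p + 1 + q).choose u : ℚ) * ((p + q).choose p : ℚ) := by
        refine Finset.sum_le_sum (fun u hu => ?_)
        rw [Finset.mem_Ioo] at hu
        -- C(n+1,u)·(n+1−u) = C(n,u)·(n+1)
        have h2 : ((p + 1 + q).choose u : ℚ) * (p + q + 1 - u) = ((p + q).choose u : ℚ) * (p + q + 1) := by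
          have h3 := (Nat.choose_mul_succ_eq (p + q) u).symm
          rw [show p + 1 + q = p + q + 1 by ring]
          have h4 : (p + q + 1 - u : ℚ) = ((p + q + 1 - u : ℕ) : ℚ) := by
            rw [Nat.cast_sub (by omega)]
            push_cast
            ring
          rw [h4]
          exact_mod_cast h3
        have hu2 : (0 : ℚ) < (p + q + 1 - u : ℚ) := by
          have : (u : ℚ) < p + q + 1 := by exact_mod_cast (by omega : u < p + q + 1)
          linarith
        have hqu : (p + q + 1 - u : ℚ) ≤ (p + 1 : ℚ) := by
          have : (q : ℚ) ≤ u := by exact_mod_cast hu.1.le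
          linarith
        have hnn : (0 : ℚ) ≤ ((p + q).choose u : ℚ) * ((p + q).choose p : ℚ) * (p + q + 1) := by
          positivity
        -- multiply both sides by the positive (p+1)·(n+1−u) and compare
        have key : ((p + q).choose u : ℚ) * ((p + 1 + q).choose (p + 1) : ℚ) * ((p + 1) * (p + q + 1 - u)) ≤
            ((p + 1 + q).choose u : ℚ) * ((p + q).choose p : ℚ) * ((p + 1) * (p + q + 1 - u)) := by
          have e1 : ((p + q).choose u : ℚ) * ((p + 1 + q).choose (p + 1) : ℚ) * ((p + 1) * (p + q + 1 - u)) =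
              ((p + q).choose u : ℚ) * ((p + q).choose p : ℚ) * (p + q + 1) * (p + q + 1 - u) := by
            linear_combination (((p + q).choose u : ℚ) * (p + q + 1 - u)) * h1
          have e2 : ((p + 1 + q).choose u : ℚ) * ((p + q).choose p : ℚ) * ((p + 1) * (p + q + 1 - u)) =
              ((p + q).choose u : ℚ) * ((p + q).choose p : ℚ) * (p + q + 1) * (p + 1) := by
            linear_combination (((p + q).choose p : ℚ) * (p + 1)) * h2
          rw [e1, e2]
          exact mul_le_mul_of_nonneg_left hqu hnn
        exact le_of_mul_le_mul_right key (by positivity)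
    _ ≤ ∑ u ∈ Finset.Ioo q (p + 1), ((p + 1 + q).choose u : ℚ) * ((p + q).choose p : ℚ) := by
        refine Finset.sum_le_sum_of_subset_of_nonneg hsub (fun u _ _ => ?_)
        positivity

/-- `Φ(p − 1, q) ≤ Φ(p, q)` for `q + 2 ≤ p`. -/
lemma phiK_pred_le (p q : ℕ) (hpq : q + 2 ≤ p) : phiK (p - 1) q ≤ phiK p q := by
  have h := phiK_le_phiK_succ (p - 1) q
  rwa [show p - 1 + 1 = p by omega] at h

/-- `0 ≤ Φ(p, q)`. -/
lemma phiK_nonneg' (p q : ℕ) : 0 ≤ phiK p q := by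
  unfold phiK
  positivity

/-- **THE TIGHT LAYER OF (MC) AT AN UNEXPOSED ELEMENT**: `|E| = p + q`, `q + 2 ≤ p`, `e` a non-loop, and no
independent `p`-set `A ∋ e` with independent complement has `e ∈ cl(E ∖ A)` (`b″(e) = 0`); then
`σ_{M ／ {e}}(p − 1, q) ≤ σ_M(p, q)` — the contraction monotonicity (MC) of C-037 at `e`. -/
theorem slack_contract_le_of_tight {e : α} (he : M.IsNonloop e) {p q : ℕ} (hpq : q + 2 ≤ p)
    (hE : M.E.ncard = p + q)
    (hb : ∀ A : Set α, A ⊆ M.E → M.Indep A → A.encard = (p : ℕ∞) → e ∈ A →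
      M.Indep (M.E \ A) → e ∉ M.closure (M.E \ A)) :
    Matroid.slack (M ／ {e}) (p - 1) q ≤ Matroid.slack M p q := by
  have hefin : (M ／ {e}).Finite := inferInstance
  have hE' : (M ／ {e}).E.ncard = (p - 1) + q := by
    rw [Matroid.contract_ground, ncard_sdiff_singleton_of_mem he.mem_ground, hE]
    omega
  -- the two slacks unfolded
  unfold Matroid.slack
  -- Y side
  have hY := sum_add_ncard_depMid_le_midCount M p q
  have hY' := midCount_le_sum_add_ncard_depMid (M ／ {e}) (p - 1) q
  have hdep := ncard_depMid_contract_le M he (p := p) (q := q) (by omega)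
  -- U side
  have hU := topCount_le_ncard_goodImg M hE
  have hU' := ncard_goodImg_le_topCount (M ／ {e}) hE'
  have hgb := ncard_goodImg_add_ncard_badImg M p
  have hgb' := ncard_goodImg_add_ncard_badImg (M ／ {e}) (p - 1)
  have hbad := ncard_badImg_contract_le M he (p := p) (by omega) hb
  -- Theorem (a_p)
  have hap := indepSlack_contract_le M he hpq (by omega)
  rw [indepSlack_eq_of_ncard_eq M hE, indepSlack_eq_of_ncard_eq (M ／ {e}) hE'] at hap
  -- Φ monotonicity
  have hphi := phiK_pred_le p q hpq
  have hphi0 := phiK_nonneg' (p - 1) q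
  -- cast everything to ℚ and conclude
  have hY_q : (∑ u ∈ Finset.Ioo q p, ((indepSets M u).card : ℚ)) + ((depMid M p q).ncard : ℚ) ≤
      (Matroid.midCount M p q : ℚ) := by exact_mod_cast hY
  have hY'_q : (Matroid.midCount (M ／ {e}) (p - 1) q : ℚ) ≤
      (∑ u ∈ Finset.Ioo q (p - 1), ((indepSets (M ／ {e}) u).card : ℚ)) +
        ((depMid (M ／ {e}) (p - 1) q).ncard : ℚ) := by exact_mod_cast hY'
  have hdep_q : ((depMid (M ／ {e}) (p - 1) q).ncard : ℚ) ≤ ((depMid M p q).ncard : ℚ) := by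
    exact_mod_cast hdep
  have hU_q : (Matroid.topCount M p q : ℚ) ≤ ((goodImg M p).ncard : ℚ) := by exact_mod_cast hU
  have hU'_q : ((goodImg (M ／ {e}) (p - 1)).ncard : ℚ) ≤ (Matroid.topCount (M ／ {e}) (p - 1) q : ℚ) := by
    exact_mod_cast hU'
  have hgb_q : ((goodImg M p).ncard : ℚ) + ((badImg M p).ncard : ℚ) = ((indepSets M p).card : ℚ) := by
    exact_mod_cast hgb
  have hgb'_q : ((goodImg (M ／ {e}) (p - 1)).ncard : ℚ) + ((badImg (M ／ {e}) (p - 1)).ncard : ℚ) =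
      ((indepSets (M ／ {e}) (p - 1)).card : ℚ) := by exact_mod_cast hgb'
  have hbad_q : ((badImg (M ／ {e}) (p - 1)).ncard : ℚ) ≤ ((badImg M p).ncard : ℚ) := by
    exact_mod_cast hbad
  have hbad0 : (0 : ℚ) ≤ ((badImg M p).ncard : ℚ) := by positivity
  -- Φ′·bad′ ≤ Φ′·bad ≤ Φ·bad
  have hm1 : phiK (p - 1) q * ((badImg (M ／ {e}) (p - 1)).ncard : ℚ) ≤
      phiK (p - 1) q * ((badImg M p).ncard : ℚ) := mul_le_mul_of_nonneg_left hbad_q hphi0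
  have hm2 : phiK (p - 1) q * ((badImg M p).ncard : ℚ) ≤ phiK p q * ((badImg M p).ncard : ℚ) :=
    mul_le_mul_of_nonneg_right hphi hbad0
  -- Φ·top ≤ Φ·good and Φ′·good′ ≤ Φ′·top′
  have hm3 : phiK p q * (Matroid.topCount M p q : ℚ) ≤ phiK p q * ((goodImg M p).ncard : ℚ) :=
    mul_le_mul_of_nonneg_left hU_q (phiK_nonneg' p q)
  have hm4 : phiK (p - 1) q * ((goodImg (M ／ {e}) (p - 1)).ncard : ℚ) ≤
      phiK (p - 1) q * (Matroid.topCount (M ／ {e}) (p - 1) q : ℚ) :=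
    mul_le_mul_of_nonneg_left hU'_q hphi0
  -- rewrite good = i_p − bad inside the products
  have hg : ((goodImg M p).ncard : ℚ) = ((indepSets M p).card : ℚ) - ((badImg M p).ncard : ℚ) := by
    linarith
  have hg' : ((goodImg (M ／ {e}) (p - 1)).ncard : ℚ) =
      ((indepSets (M ／ {e}) (p - 1)).card : ℚ) - ((badImg (M ／ {e}) (p - 1)).ncard : ℚ) := by
    linarith
  rw [hg] at hm3
  rw [hg'] at hm4
  nlinarith [hm1, hm2, hm3, hm4, hap, hY_q, hY'_q, hdep_q]

/-- **THE TIGHT LAYER OF (MC) AT AN ELEMENT IN NO SHORT CIRCUIT**: `|E| = p + q`, `q + 2 ≤ p`, `e` a non-loop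
lying in no circuit of size `≤ q + 1`; then `σ_{M ／ {e}}(p − 1, q) ≤ σ_M(p, q)`. -/
theorem slack_contract_le_of_tight_of_circuits {e : α} (he : M.IsNonloop e) {p q : ℕ}
    (hpq : q + 2 ≤ p) (hE : M.E.ncard = p + q)
    (hc : ∀ C : Set α, M.IsCircuit C → e ∈ C → ((q + 2 : ℕ) : ℕ∞) ≤ C.encard) :
    Matroid.slack (M ／ {e}) (p - 1) q ≤ Matroid.slack M p q := by
  refine slack_contract_le_of_tight M he hpq hE ?_
  intro A hAE hAind hcard heA hind' hecl
  have hEfin : M.E.Finite := M.set_finite M.E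
  have hAfin : A.Finite := hEfin.subset hAE
  have hAcard : A.ncard = p := by
    rw [← hAfin.cast_ncard_eq] at hcard
    exact_mod_cast hcard
  have hsum := ncard_sdiff_add_ncard_of_subset hAE hEfin
  have hEAcard : (M.E \ A).encard = (q : ℕ∞) := by
    rw [← (hEfin.subset sdiff_subset).cast_ncard_eq]
    have : (M.E \ A).ncard = q := by omega
    rw [this]
  have heEA : e ∉ M.E \ A := fun h => h.2 heA
  have hC := hind'.fundCircuit_isCircuit hecl heEA
  have hle := hc _ hC (M.mem_fundCircuit e (M.E \ A))
  have hsub := encard_le_encard (M.fundCircuit_subset_insert e (M.E \ A))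
  rw [encard_insert_of_notMem heEA, hEAcard] at hsub
  have hlt : ((q : ℕ) : ℕ∞) + 1 < ((q + 2 : ℕ) : ℕ∞) := by
    norm_cast
    omega
  exact absurd (lt_of_lt_of_le hlt hle) (not_lt.2 hsub)

end PercRepro
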